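import Summits.BirchSwinnertonDyer.BirchSwinnertonDyer.Theorems.ResidualThetaTransportAtTwoThetaLayerLambdaCongruenceAtTwoOfBz
import Literature.NumberTheory.EllipticCurves.ModularJacobianMultiplicityOneOfGammaOneCover
import HarnessLib

/-!
# Kan⁺ `ThetaLayerLambdaCongruenceAtTwo` from the `J₁(N)`-cover fact

Third companion of `…ThetaLayerLambdaCongruenceAtTwoOfBz.lean` / `…OfGaloisData.lean` / `…OfEichlerShimura.lean`:
the crux `stmt-BirchSwinnertonDyer-20688` (route `ResidualThetaTransportAtTwo`) displayed CONDITIONAL on exactly ONE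
cited existence fact, `nonempty_modularJacobianGammaOneCover`
(`Literature/NumberTheory/EllipticCurves/ModularJacobianGammaOneCover.lean`: the cover `π : X₁(N) → X₀(N)` on the
torsion of the Jacobians with Eichler–Shimura (Darmon–Diamond–Taylor Thm. 1.29), the Shimura subgroup with abelian
Galois action (Buzzard 2000 Lemma 2.3 ⟸ Ling–Oesterlé) and mod-`ℓ` multiplicity one for `J₁(N)` (Buzzard's appendix
to Ribet–Stein, Thm. 6.1 at weight `2`)). Kernel road:
`thetaLayerLambdaCongruenceAtTwo_of_bz ∘ buzzard2000_multiplicityOne_gamma0_of_gammaOneCover`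
(the latter = `Literature/…/ModularJacobianMultiplicityOneOfGammaOneCover.lean`: the `J₁(N)` input `hJ₁` of
Buzzard's proof of Prop. 2.4 is DERIVED from the cover, then `buzzard2000_multiplicityOne_gamma0_of_galoisData`).

HONESTY: CONDITIONAL — Kan⁺ is NOT settled by this file (the cover fact is cited, not proved: no `J₁(N)` over `ℚ`
and no finite flat group schemes in the tree) and BSD is not proved by any of this.
-/

set_option autoImplicit false

noncomputable section

-- justification: the `Summit.BirchSwinnertonDyer.BirchSwinnertonDyer.…` path repeats a component (route-file convention)
set_option linter.dupNamespace false

open Literature.NumberTheory.EllipticCurves.ModularForms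
open Summit.BirchSwinnertonDyer.BirchSwinnertonDyer.Theses.ResidualThetaTransportAtTwo

namespace Summit.BirchSwinnertonDyer.BirchSwinnertonDyer.Theorems.ThetaLayerLambdaCongruenceAtTwo

/-- **Kan⁺ `ThetaLayerLambdaCongruenceAtTwo` BY NAME from the `J₁(N)`-cover fact** —
`thetaLayerLambdaCongruenceAtTwo_of_bz` composed with `buzzard2000_multiplicityOne_gamma0_of_gammaOneCover`
(Buzzard 2000 Prop. 2.4 derived in kernel from the cover data). Hypothesis: the single named fact
`nonempty_modularJacobianGammaOneCover`. CONDITIONAL; Kan⁺ is NOT settled and BSD is not proved by this.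
[cite: Buzzard2000LevelLoweringModTwo, Lemma 2.3 and Prop. 2.4 (p. 101)]
[cite: RibetStein2008, Appendix (K. Buzzard), Thm. 6.1 (pp. 81–82)]
[cite: DarmonDiamondTaylor1995, Thm. 1.29 (p. 37)] -/
theorem thetaLayerLambdaCongruenceAtTwo_of_gammaOneCover
    (h : nonempty_modularJacobianGammaOneCover) : ThetaLayerLambdaCongruenceAtTwo :=
  thetaLayerLambdaCongruenceAtTwo_of_bz (buzzard2000_multiplicityOne_gamma0_of_gammaOneCover h)

end Summit.BirchSwinnertonDyer.BirchSwinnertonDyer.Theorems.ThetaLayerLambdaCongruenceAtTwo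

end
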